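import Summits.ValiantsHypothesis.ValiantsHypothesis.Theorems.KPlusLogSqLawStaticCyclicBandPrelim

/-!
# Route «KPlusLogSqLaw» — dominant chains of STATIC CYCLIC-BAND designs have `O(m log m)` terms; `K` classes: `O(K m² log m)`

HONEST FRAMING.  Helper toward the crux `WeakLifting` (item `stmt-ValiantsHypothesis-19561`, route `KPlusLogSqLaw`, cell `pub-symmetroid`,
seat val-sym-lift-p3 g7, 2026-08-27) and the cell's D2 «rotation route» at cyclic bandwidth one (HOME/val-sym-lift-p1/g7/K4-JOINT-OBSTRUCTION-DIGEST.md
§3: the quantity `N(P, 1)`): the CYCLIC band support `j ≡ i, i ± 1 (mod m)` — the tridiagonal band plus the two corner entries `(0, m−1)`, `(m−1, 0)`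
— is covered neither by `chain_le_banded` (non-cyclic bands) nor by `tropicalB_hessenberg` (the corner `(m−1, 0)` is below the Hessenberg line) nor by
`cyclicBidiagonal_chain_le` (one cyclic off-diagonal only).  PROVED HERE:
* `StaticCyclicBand.chain_succ_le_static`: every chain of distinct consecutive dominant terms of a STATIC cyclic-band design (each present entry lies
  in the cyclic band and carries the class `cls i j`) has `n + 1 ≤ 2·(66(m−1)(⌊log₂(m−1)⌋+2) + 1) + 2`;
* `StaticCyclicBand.chain_succ_le` / `_of_alternating`: with ARBITRARY classes on the cyclic band,
  `n + 1 ≤ ((3m+2)K + 1)·(2·(66(m−1)(⌊log₂(m−1)⌋+2)+1) + 2)` = `O(K m² log m)` (the support-restricted static reduction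
  `StaticReduction.chain_succ_le`, p538011, with `≤ 3m + 2` cyclic-band entries) — the first polynomial kernel bound for this sector.
PROOF of the static law (m ≥ 3; for m ≤ 2 the cyclic band is the ordinary band): split the chain indices by the use of the two corner ENTRIES.
(A) terms using neither corner are terms of the corner-free design — a static TRIDIAGONAL design — and dominant there (fewer competitors):
`StaticTridiagonal.chain_le_of_support` bounds this subsequence.  (B) terms using both corners (`σ 0 = m−1`, `σ (m−1) = 0`): SWAP THE COLUMNS `0` and
`m−1` of the design and of every term (`q ↦ (σ·τ, λ∘τ)`, `τ = swap 0 (m−1)`): weights are unchanged and signs flip uniformly, so dominance transfers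
to the column-swapped design, in which these terms use `(0,0)`, `(m−1,m−1)` and band entries only — again a static tridiagonal chain after deleting
the unused off-band entries.  (C) a term using exactly one corner is FORCED to be the rotation (`σ j = j+1` resp. `j−1` around the cycle,
`perm_val_of_corner₁/₂`), so with static classes there is one such term of each kind, and a dominant chain visits each term at most once
(the tree's `injective_of_chainD`).  Subsequences are re-indexed by `Finset.orderEmbOfFin`.
Nothing here asserts anything about `WeakLifting`, `TropicalB`, `KPlusLogSqLaw`, the D2 fork, `MatrixDescartes` (stmt-ValiantsHypothesis-18050) or
`VP ≠ VNP`.  [folklore] (matchings of a cycle; bookkeeping).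
-/

set_option linter.dupNamespace false
set_option autoImplicit false

namespace Summit.ValiantsHypothesis.ValiantsHypothesis.Theorems.KPlusLogSqLaw

open Finset Classical
open Summit.ValiantsHypothesis.ValiantsHypothesis.Theorems.MatrixDescartes.Negative

namespace StaticCyclicBand

variable {m K : ℕ}

/-! ## 4. The static cyclic-band law -/

/-- **DOMINANT CHAINS OF A STATIC CYCLIC-BAND DESIGN HAVE `O(m log m)` TERMS**: if every present entry `(i, j)` of the dominance design `(d, v, ε)`
lies in the cyclic band (`|i − j| ≤ 1` or `{i, j} = {0, m−1}`) and carries the class `cls i j`, then every chain of distinct consecutive dominant terms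
has `n + 1 ≤ 2·(66(m−1)(⌊log₂(m−1)⌋+2) + 1) + 2`. [folklore] -/
theorem chain_succ_le_static (d : Fin K → ℕ) (v ε : Fin m → Fin m → Fin K → ℤ) (cls : Fin m → Fin m → Fin K)
    (hε : ∀ i j l, ε i j l ≠ 0 → ((((i : ℕ) ≤ j + 1 ∧ (j : ℕ) ≤ i + 1) ∨ ((i : ℕ) = 0 ∧ (j : ℕ) = m - 1) ∨ ((i : ℕ) = m - 1 ∧ (j : ℕ) = 0))
      ∧ l = cls i j))
    (n : ℕ) (θ : Fin (n + 1) → ℤ) (p : Fin (n + 1) → Equiv.Perm (Fin m) × (Fin m → Fin K)) (hθ : StrictMono θ)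
    (hdom : ∀ k, IsDominant d v ε (θ k) (p k)) (hne : ∀ k : Fin n, p k.castSucc ≠ p k.succ) :
    n + 1 ≤ 2 * (66 * (m - 1) * (Nat.log 2 (m - 1) + 2) + 1) + 2 := by
  set L := 66 * (m - 1) * (Nat.log 2 (m - 1) + 2) with hL
  -- small sizes: the cyclic band is the ordinary band
  by_cases hm : m < 3
  · have hband : ∀ i j l, ε i j l ≠ 0 → (((i : ℕ) ≤ j + 1 ∧ (j : ℕ) ≤ i + 1) ∧ l = cls i j) := by
      intro i j l h
      obtain ⟨hc, hl⟩ := hε i j l h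
      refine ⟨?_, hl⟩
      have hi := i.isLt; have hj := j.isLt
      rcases hc with hc | hc | hc <;> omega
    have := StaticTridiagonal.chain_le_of_support d v ε cls hband n θ p hθ hdom hne
    omega
  rw [not_lt] at hm
  have hm0 : 0 < m := by omega
  -- the two corner entries, seen from the columns
  let c0 : Fin m := ⟨0, hm0⟩
  let cL : Fin m := ⟨m - 1, by omega⟩
  have hc0L : c0 ≠ cL := by intro h; have := congrArg Fin.val h; simp [c0, cL] at this; omega
  let U₁ : Fin (n + 1) → Prop := fun k => (((p k).1 cL : Fin m) : ℕ) = 0       -- uses the corner `(0, m-1)`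
  let U₂ : Fin (n + 1) → Prop := fun k => (((p k).1 c0 : Fin m) : ℕ) = m - 1   -- uses the corner `(m-1, 0)`
  -- band facts for the columns of a chain term
  have hcol : ∀ k (j : Fin m), ((((p k).1 j : ℕ) ≤ j + 1 ∧ (j : ℕ) ≤ ((p k).1 j : ℕ) + 1) ∨
      ((((p k).1 j : Fin m) : ℕ) = 0 ∧ (j : ℕ) = m - 1) ∨ ((((p k).1 j : Fin m) : ℕ) = m - 1 ∧ (j : ℕ) = 0)) := fun k j =>
    (hε _ _ _ (LacunarySymmetroidMatrixDescartes.TropicalCensus.present_of_termSign_ne_zero ε (p k) (hdom k).1 j)).1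
  have hcls : ∀ k (j : Fin m), (p k).2 j = cls ((p k).1 j) j := fun k j =>
    (hε _ _ _ (LacunarySymmetroidMatrixDescartes.TropicalCensus.present_of_termSign_ne_zero ε (p k) (hdom k).1 j)).2
  have hinj := injective_of_chainD d v ε θ p hθ hdom hne
  -- the four index classes
  let SA : Finset (Fin (n + 1)) := univ.filter fun k => ¬ U₁ k ∧ ¬ U₂ k
  let SB : Finset (Fin (n + 1)) := univ.filter fun k => U₁ k ∧ U₂ k
  let S₁ : Finset (Fin (n + 1)) := univ.filter fun k => U₁ k ∧ ¬ U₂ k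
  let S₂ : Finset (Fin (n + 1)) := univ.filter fun k => ¬ U₁ k ∧ U₂ k
  have hcover : (univ : Finset (Fin (n + 1))) = SA ∪ SB ∪ S₁ ∪ S₂ := by
    ext k; simp only [mem_univ, mem_union, mem_filter, true_and, true_iff, SA, SB, S₁, S₂]; tauto
  -- (A) corner-free terms: a static TRIDIAGONAL chain
  have hA : SA.card ≤ L + 1 := by
    let εA : Fin m → Fin m → Fin K → ℤ := fun i j l => if ((i : ℕ) ≤ j + 1 ∧ (j : ℕ) ≤ i + 1) then ε i j l else 0
    have hsubA : ∀ i j l, εA i j l ≠ 0 → εA i j l = ε i j l := by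
      intro i j l h
      simp only [εA] at h ⊢
      by_cases hh : ((i : ℕ) ≤ j + 1 ∧ (j : ℕ) ≤ i + 1)
      · rw [if_pos hh]
      · rw [if_neg hh] at h; exact absurd rfl h
    have hstatA : ∀ i j l, εA i j l ≠ 0 → (((i : ℕ) ≤ j + 1 ∧ (j : ℕ) ≤ i + 1) ∧ l = cls i j) := by
      intro i j l h; simp only [εA] at h; split_ifs at h with hh
      · exact ⟨hh, (hε i j l h).2⟩
      · exact absurd rfl h
    refine card_le_of_subchain d v ε v εA θ p hθ hdom hne id Function.injective_id SA ?_ L ?_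
    · intro k hk
      obtain ⟨h1, h2⟩ := (mem_filter.mp hk).2
      refine isDominant_restrict d v ε εA hsubA (θ k) (hdom k) ?_
      -- every column of `p k` is a band entry
      unfold termSign
      refine mul_ne_zero (by exact_mod_cast (Equiv.Perm.sign (p k).1).ne_zero) (prod_ne_zero_iff.mpr fun j _ => ?_)
      have hpres := LacunarySymmetroidMatrixDescartes.TropicalCensus.present_of_termSign_ne_zero ε (p k) (hdom k).1 j
      simp only [εA]
      rw [if_pos]; · exact hpres
      rcases hcol k j with hb | hb | hb
      · exact hb
      · exfalso; apply h1; show (((p k).1 cL : Fin m) : ℕ) = 0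
        have : j = cL := Fin.ext hb.2; rw [← this]; exact hb.1
      · exfalso; apply h2; show (((p k).1 c0 : Fin m) : ℕ) = m - 1
        have : j = c0 := Fin.ext hb.2; rw [← this]; exact hb.1
    · intro n' θ' p' hθ' hdom' hne'
      exact StaticTridiagonal.chain_le_of_support d v εA cls hstatA n' θ' p' hθ' hdom' hne'
  -- (B) both corners: swap the columns `0` and `m-1`
  have hB : SB.card ≤ L + 1 := by
    let τ : Equiv.Perm (Fin m) := Equiv.swap c0 cL
    let vB : Fin m → Fin m → Fin K → ℤ := fun i j l => v i (τ j) l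
    let εB : Fin m → Fin m → Fin K → ℤ := fun i j l => if ((i : ℕ) ≤ j + 1 ∧ (j : ℕ) ≤ i + 1) then ε i (τ j) l else 0
    let clsB : Fin m → Fin m → Fin K := fun i j => cls i (τ j)
    have hsubB : ∀ i j l, εB i j l ≠ 0 → εB i j l = ε i (τ j) l := by
      intro i j l h
      simp only [εB] at h ⊢
      by_cases hh : ((i : ℕ) ≤ j + 1 ∧ (j : ℕ) ≤ i + 1)
      · rw [if_pos hh]
      · rw [if_neg hh] at h; exact absurd rfl h
    have hstatB : ∀ i j l, εB i j l ≠ 0 → (((i : ℕ) ≤ j + 1 ∧ (j : ℕ) ≤ i + 1) ∧ l = clsB i j) := by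
      intro i j l h; simp only [εB] at h; split_ifs at h with hh
      · exact ⟨hh, (hε i (τ j) l h).2⟩
      · exact absurd rfl h
    refine card_le_of_subchain d v ε vB εB θ p hθ hdom hne (fun q => (q.1 * τ, q.2 ∘ τ)) (colSwap_injective τ) SB ?_ L ?_
    · intro k hk
      obtain ⟨h1, h2⟩ := (mem_filter.mp hk).2
      have hdk := isDominant_colSwap d v ε τ (θ k) (hdom k)
      refine isDominant_restrict d vB (fun i j l => ε i (τ j) l) εB hsubB (θ k) hdk ?_
      unfold termSign
      refine mul_ne_zero (by exact_mod_cast (Equiv.Perm.sign ((p k).1 * τ)).ne_zero) (prod_ne_zero_iff.mpr fun j _ => ?_)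
      simp only [Equiv.Perm.coe_mul, Function.comp_apply, εB]
      have hpres := LacunarySymmetroidMatrixDescartes.TropicalCensus.present_of_termSign_ne_zero ε (p k) (hdom k).1 (τ j)
      rw [if_pos]; · exact hpres
      -- the swapped term stays in the band at every column
      by_cases hj0 : j = c0
      · subst hj0
        have : τ c0 = cL := Equiv.swap_apply_left _ _
        rw [this]
        have h1' : (((p k).1 cL : Fin m) : ℕ) = 0 := h1
        simp [c0, h1']
      · by_cases hjL : j = cL
        · subst hjL
          have : τ cL = c0 := Equiv.swap_apply_right _ _
          rw [this]
          have h2' : (((p k).1 c0 : Fin m) : ℕ) = m - 1 := h2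
          simp [cL, h2']
        · have : τ j = j := Equiv.swap_apply_of_ne_of_ne hj0 hjL
          rw [this]
          rcases hcol k j with hb | hb | hb
          · exact hb
          · exact absurd (Fin.ext hb.2) hjL
          · exact absurd (Fin.ext hb.2) hj0
    · intro n' θ' p' hθ' hdom' hne'
      exact StaticTridiagonal.chain_le_of_support d vB εB clsB hstatB n' θ' p' hθ' hdom' hne'
  -- (C) exactly one corner: forced rotations, one term each
  have hC₁ : S₁.card ≤ 1 := by
    refine card_le_one.mpr fun a ha b hb => ?_
    obtain ⟨ha1, ha2⟩ := (mem_filter.mp ha).2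
    obtain ⟨hb1, hb2⟩ := (mem_filter.mp hb).2
    apply hinj
    have hσ : ∀ k, U₁ k → ¬ U₂ k → ∀ j : Fin m, (j : ℕ) < m - 1 → ((((p k).1 j) : Fin m) : ℕ) = j + 1 := by
      intro k hk1 hk2
      refine perm_val_of_corner₁ hm (p k).1 hk1 fun j hj => ?_
      rcases hcol k j with hb | hb | hb
      · exact hb
      · omega
      · exact absurd hb.1 (by intro h; apply hk2; show (((p k).1 c0 : Fin m) : ℕ) = m - 1; have : j = c0 := Fin.ext hb.2; rw [← this]; exact h)
    have hperm : (p a).1 = (p b).1 := by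
      refine Equiv.ext fun j => Fin.ext ?_
      by_cases hj : (j : ℕ) < m - 1
      · rw [hσ a ha1 ha2 j hj, hσ b hb1 hb2 j hj]
      · have : j = cL := Fin.ext (by simp [cL]; have := j.isLt; omega)
        rw [this]; exact ha1.trans hb1.symm
    exact Prod.ext hperm (funext fun j => by rw [hcls a j, hcls b j, hperm])
  have hC₂ : S₂.card ≤ 1 := by
    refine card_le_one.mpr fun a ha b hb => ?_
    obtain ⟨ha1, ha2⟩ := (mem_filter.mp ha).2
    obtain ⟨hb1, hb2⟩ := (mem_filter.mp hb).2
    apply hinj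
    have hσ : ∀ k, ¬ U₁ k → U₂ k → ∀ j : Fin m, 0 < (j : ℕ) → ((((p k).1 j) : Fin m) : ℕ) + 1 = j := by
      intro k hk1 hk2
      refine perm_val_of_corner₂ hm (p k).1 hk2 fun j hj => ?_
      rcases hcol k j with hb | hb | hb
      · exact hb
      · exact absurd hb.1 (by intro h; apply hk1; show (((p k).1 cL : Fin m) : ℕ) = 0; have : j = cL := Fin.ext hb.2; rw [← this]; exact h)
      · omega
    have hperm : (p a).1 = (p b).1 := by
      refine Equiv.ext fun j => Fin.ext ?_
      by_cases hj : 0 < (j : ℕ)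
      · have e1 := hσ a ha1 ha2 j hj; have e2 := hσ b hb1 hb2 j hj; omega
      · have : j = c0 := Fin.ext (by simp [c0]; omega)
        rw [this]; exact ha2.trans hb2.symm
    exact Prod.ext hperm (funext fun j => by rw [hcls a j, hcls b j, hperm])
  -- count
  have hcard : (univ : Finset (Fin (n + 1))).card ≤ SA.card + SB.card + S₁.card + S₂.card := by
    rw [hcover]
    exact (card_union_le _ _).trans (Nat.add_le_add_right ((card_union_le _ _).trans
      (Nat.add_le_add_right (card_union_le _ _) _)) _)
  rw [card_univ, Fintype.card_fin] at hcard
  omega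

/-! ## 5. Arbitrary classes on the cyclic band -/

/-- the cyclic band has at most `3m + 2` entries. [folklore] -/
theorem card_cyclicBand_le (m : ℕ) :
    ((univ : Finset (Fin m × Fin m)).filter fun e =>
      (((e.1 : ℕ) ≤ e.2 + 1 ∧ (e.2 : ℕ) ≤ e.1 + 1) ∨ ((e.1 : ℕ) = 0 ∧ (e.2 : ℕ) = m - 1) ∨ ((e.1 : ℕ) = m - 1 ∧ (e.2 : ℕ) = 0))).card
      ≤ 3 * m + 2 := by
  have hsub : ((univ : Finset (Fin m × Fin m)).filter fun e =>
      (((e.1 : ℕ) ≤ e.2 + 1 ∧ (e.2 : ℕ) ≤ e.1 + 1) ∨ ((e.1 : ℕ) = 0 ∧ (e.2 : ℕ) = m - 1) ∨ ((e.1 : ℕ) = m - 1 ∧ (e.2 : ℕ) = 0))) ⊆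
      ((univ : Finset (Fin m × Fin m)).filter fun e => ((e.1 : ℕ) ≤ e.2 + 1 ∧ (e.2 : ℕ) ≤ e.1 + 1)) ∪
      ((univ : Finset (Fin m × Fin m)).filter fun e => ((e.1 : ℕ) = 0 ∧ (e.2 : ℕ) = m - 1) ∨ ((e.1 : ℕ) = m - 1 ∧ (e.2 : ℕ) = 0)) := by
    intro e he
    rw [mem_filter] at he
    rw [mem_union, mem_filter, mem_filter]
    rcases he.2 with h | h | h
    · exact Or.inl ⟨mem_univ _, h⟩
    · exact Or.inr ⟨mem_univ _, Or.inl h⟩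
    · exact Or.inr ⟨mem_univ _, Or.inr h⟩
  have h2 : (((univ : Finset (Fin m × Fin m)).filter fun e =>
      ((e.1 : ℕ) = 0 ∧ (e.2 : ℕ) = m - 1) ∨ ((e.1 : ℕ) = m - 1 ∧ (e.2 : ℕ) = 0))).card ≤ 2 := by
    rcases Nat.eq_zero_or_pos m with h0 | h0
    · subst h0
      rw [Finset.univ_eq_empty, filter_empty, card_empty]; omega
    · let a : Fin m × Fin m := (⟨0, h0⟩, ⟨m - 1, by omega⟩)
      let b : Fin m × Fin m := (⟨m - 1, by omega⟩, ⟨0, h0⟩)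
      calc _ ≤ ({a, b} : Finset (Fin m × Fin m)).card := by
            refine card_le_card fun e he => ?_
            rw [mem_filter] at he
            rw [mem_insert, mem_singleton]
            rcases he.2 with h | h
            · left; exact Prod.ext (Fin.ext h.1) (Fin.ext h.2)
            · right; exact Prod.ext (Fin.ext h.1) (Fin.ext h.2)
        _ ≤ 2 := card_insert_le _ _ |>.trans (by simp)
  calc _ ≤ _ := card_le_card hsub
    _ ≤ _ := card_union_le _ _
    _ ≤ 3 * m + 2 := Nat.add_le_add (BandOneClasses.card_band_le m) h2

/-- **CYCLIC BAND, ARBITRARY CLASSES**: every chain of distinct consecutive dominant terms of a design of format `(m, K)` whose present entries lie in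
the cyclic band has `n + 1 ≤ ((3m+2)·K + 1)·(2·(66(m−1)(⌊log₂(m−1)⌋+2)+1) + 2)` — `O(K m² log m)`. [folklore] -/
theorem chain_succ_le (d : Fin K → ℕ) (v ε : Fin m → Fin m → Fin K → ℤ)
    (hε : ∀ i j l, ε i j l ≠ 0 → (((i : ℕ) ≤ j + 1 ∧ (j : ℕ) ≤ i + 1) ∨ ((i : ℕ) = 0 ∧ (j : ℕ) = m - 1) ∨ ((i : ℕ) = m - 1 ∧ (j : ℕ) = 0)))
    (n : ℕ) (θ : Fin (n + 1) → ℤ) (p : Fin (n + 1) → Equiv.Perm (Fin m) × (Fin m → Fin K)) (hθ : StrictMono θ)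
    (hdom : ∀ k, IsDominant d v ε (θ k) (p k)) (hne : ∀ k : Fin n, p k.castSucc ≠ p k.succ) :
    n + 1 ≤ ((3 * m + 2) * K + 1) * (2 * (66 * (m - 1) * (Nat.log 2 (m - 1) + 2) + 1) + 1 + 1) := by
  refine StaticReduction.chain_succ_le d v ε
    (fun i j => (((i : ℕ) ≤ j + 1 ∧ (j : ℕ) ≤ i + 1) ∨ ((i : ℕ) = 0 ∧ (j : ℕ) = m - 1) ∨ ((i : ℕ) = m - 1 ∧ (j : ℕ) = 0)))
    (3 * m + 2) (by convert card_cyclicBand_le m) hε _ ?_ n θ p hθ hdom hne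
  intro cls n' θ' p' hθ' hdom' hne'
  have h := chain_succ_le_static d v (fun i j l => if l = cls i j then ε i j l else 0) cls (fun i j l hl => ?_) n' θ' p' hθ' hdom' hne'
  · omega
  · by_cases hc : l = cls i j
    · rw [if_pos hc] at hl; exact ⟨hε i j l hl, hc⟩
    · rw [if_neg hc] at hl; exact absurd rfl hl

/-- **corollary in `TropRootLawAt` currency**: alternating chains of cyclic-band designs. [folklore] -/
theorem chain_succ_le_of_alternating (d : Fin K → ℕ) (v ε : Fin m → Fin m → Fin K → ℤ)
    (hε : ∀ i j l, ε i j l ≠ 0 → (((i : ℕ) ≤ j + 1 ∧ (j : ℕ) ≤ i + 1) ∨ ((i : ℕ) = 0 ∧ (j : ℕ) = m - 1) ∨ ((i : ℕ) = m - 1 ∧ (j : ℕ) = 0)))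
    (n : ℕ) (θ : Fin (n + 1) → ℤ) (p : Fin (n + 1) → Equiv.Perm (Fin m) × (Fin m → Fin K)) (hθ : StrictMono θ)
    (hdom : ∀ k, IsDominant d v ε (θ k) (p k))
    (halt : ∀ k : Fin n, termSign ε (p k.castSucc) * termSign ε (p k.succ) < 0) :
    n + 1 ≤ ((3 * m + 2) * K + 1) * (2 * (66 * (m - 1) * (Nat.log 2 (m - 1) + 2) + 1) + 1 + 1) := by
  refine chain_succ_le d v ε hε n θ p hθ hdom fun k heq => ?_
  have h := halt k
  rw [heq] at h
  exact absurd h (not_lt.mpr (mul_self_nonneg _))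

end StaticCyclicBand

end Summit.ValiantsHypothesis.ValiantsHypothesis.Theorems.KPlusLogSqLaw
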